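import Summits.QuantumFields.YangMills.Theorems.BalabanUVNodesK0RecordFormatNamesLemmas8

/-!
# NODE O port PT-A — ROW (b) AT THE RECORD FROM PER-CUBE BOUNDS: `IntFormula.Bound118OnUc` ⟸ [II] p.21's `LogHalfBound` (‖E(X)‖ ≤ B·#cubes(X)·e^{−r d(X)}) at every volume,
# by the tree's `B13.bound118_of_logHalfBound` + the torus volume leaf `TreeLengthTorus.tvolumeLeaf` (`#cubes(X) ≤ 4·2⁴(1 + d(X))`) — the passage the `Ψ_LZ` half of the residue takes
# ([16] (63) walk terms «summed with the same localization X» give the per-cube shape, `B10LogDet63.logHalfBound_of_walks`; the (1.18) shape follows with `E₀ = 64·B`, `κ = r − 1`)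

Cell `ym-nodeO-ideate`, porter seat `ymgap-nodeO-port-PTA-1` (gen 3); `--supports stmt-QuantumFields-27930` (helper).  [I] = [Balaban1987RG1], [II] = [Balaban1988RG2Cluster],
[16] = [Balaban1985UVStability3D].  Vocabulary: DEF-1 edition 13 (`IntFormula.piece`, `Bound118OnUc`) ∕ lemma file 8 (`bound118OnUc_iff`); the record catalogue
`recordDomSys F Mc k K = Sect2.domSys (F.P K) Mc (k+1) = TreeLengthTorus.tsys 4 (domCount …)` (so the torus volume leaf applies BY NAME; cube count `nX X = #X.1`).

* §1 `bound118OnUc_iff_bound118` — the residue's (b) row IS the tree's one-system predicate `B13.Bound118` at every volume `K₀ + n`, at the spaces `{φ | encodeCfg φ ∈ recordUc … X}`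
  and the pieces `Ψ.piece` (`Iff`, definitional bookkeeping).
* §2 ★ `bound118OnUc_of_logHalfBound` — per-cube bounds `B13.LogHalfBound (recordDomSys …) sp (Ψ.piece …) (X ↦ #X.1) B r` at every volume with VOLUME-UNIFORM `(B, r)` give
  `Ψ.Bound118OnUc F Mc k α₀ α₁ (B · (4·2⁴)) (r − 1)` (CRIT-1 Q-10 reading (b): the per-cube constant `B` is what the kernel chain gives; whether `B` is ABSOLUTE — reading (a),
  per-site smallness — is the UNPRINTED point G-B13-12a and is neither premised nor concluded here).
* §3 `bound118OnUc_mono` — (b) is monotone in its constants (larger `E₀`, smaller `κ`).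

HONEST FRAMING.  Bookkeeping by name over the tree's real-arithmetic lemma; NO walk bound ((23) of [16]) and NO per-cube bound is asserted; the residue is NOT proved; 27930 OPEN;
K0⁷ NOT closed; NODE O 0∕1; COUNT 8∕28 · K 1∕4 UNMOVED; finite `𝕋⁴_{L^K}` at fixed ε — NOT continuum ∕ OS ∕ Clay; **the Yang–Mills mass gap is NOT proved by any of this.**
No `sorry`, no `def`, no `instance`; standard axioms.
-/

noncomputable section

open scoped BigOperators Matrix.Norms.L2Operator Topology

namespace Summit.QuantumFields.YangMills.Theorems.BalabanUVNodesPortS1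

open Summit.QuantumFields.YangMills.Theorems.K0RecordFormatNames
open Literature.MathematicalPhysics.QuantumFieldTheory.Balaban1983to89
open Literature.MathematicalPhysics.QuantumFieldTheory.Balaban1983to89.Node00
open Literature.MathematicalPhysics.QuantumFieldTheory.Balaban1983to89.T4Continuum (T4Family)
open Literature.MathematicalPhysics.QuantumFieldTheory.Balaban1983to89.TreeLengthTorus (tsys tcubeSys tvolumeLeaf tcubeSys_vol)

variable (F : T4Family)

/-! ## §1  The residue's (b) row IS `B13.Bound118` at every volume -/

/-- **(b) of the residue ⟺ the tree's `B13.Bound118` at every volume** `K₀ + n`, spaces `{φ | encodeCfg φ ∈ recordUc … X}`, pieces `Ψ.piece`.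
[cite: Balaban1987RG1, (1.18) p.263 (bookkeeping)] -/
theorem bound118OnUc_iff_bound118 (Ψ : IntFormula) (Mc k : ℕ) (α₀ α₁ E₀ κ : ℝ) :
    Ψ.Bound118OnUc F Mc k α₀ α₁ E₀ κ ↔
      ∀ n, B13.Bound118 (recordDomSys F Mc k (recordK₀ F Mc k + n))
        (fun X => {φ : Sect2.CPair (F.P (recordK₀ F Mc k + n)) (MatA 2) |
          encodeCfg F (recordK₀ F Mc k + n) φ ∈ recordUc F Mc k α₀ α₁ (recordK₀ F Mc k + n) X})
        (fun X φ => Ψ.piece F Mc k (recordK₀ F Mc k + n) X φ) E₀ κ := by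
  rw [IntFormula.bound118OnUc_iff]
  exact ⟨fun h n X φ hφ => h n X φ hφ, fun h n X φ hφ => h n X φ hφ⟩

/-! ## §2  ★ (b) from per-cube bounds with volume-uniform constants -/

/-- ★ **ROW (b) AT THE RECORD FROM PER-CUBE BOUNDS** ([II] p.21 closing paragraph, the `log Z^{(k)}` half's printed shape): if at EVERY volume `K₀ + n` the pieces of `Ψ` obey
`‖Ψ.piece … X φ‖ ≤ B · #cubes(X) · e^{−r d_{k+1}(X)}` on the record spaces (`B13.LogHalfBound`, cube count of the torus catalogue) with the SAME `B ≥ 0` and `r`, then the (1.18) row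
holds with `E₀ = B · (4·2⁴)` and `κ = r − 1` — `B13.bound118_of_logHalfBound` (`1 + d ≤ e^d`) with the torus volume law `#cubes(X) ≤ 4·2^d (1 + d(X))`
(`TreeLengthTorus.tvolumeLeaf`, `tcubeSys_vol`), `d = 4`. [cite: Balaban1988RG2Cluster, p.21 (closing paragraph), (2.30) p.18; Balaban1987RG1, (1.18) p.263; Balaban1985UVStability3D, (23)–(25) p.262] -/
theorem bound118OnUc_of_logHalfBound (Ψ : IntFormula) (Mc k : ℕ) (α₀ α₁ B r : ℝ) (hB : 0 ≤ B)
    (hlog : ∀ n, B13.LogHalfBound (recordDomSys F Mc k (recordK₀ F Mc k + n))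
        (fun X => {φ : Sect2.CPair (F.P (recordK₀ F Mc k + n)) (MatA 2) |
          encodeCfg F (recordK₀ F Mc k + n) φ ∈ recordUc F Mc k α₀ α₁ (recordK₀ F Mc k + n) X})
        (fun X φ => Ψ.piece F Mc k (recordK₀ F Mc k + n) X φ)
        (fun X => (X.1 : Finset _).card) B r) :
    Ψ.Bound118OnUc F Mc k α₀ α₁ (B * (4 * 2 ^ 4)) (r - 1) := by
  rw [bound118OnUc_iff_bound118]
  intro n
  have hvol : B13.VolBoundK1 (recordDomSys F Mc k (recordK₀ F Mc k + n)) (fun X => (X.1 : Finset _).card) (4 * 2 ^ 4) := by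
    intro X
    have h := tvolumeLeaf (F.P (recordK₀ F Mc k + n)).d (Sect2.domCount (F.P (recordK₀ F Mc k + n)) Mc (k + 1)) X
    rw [tcubeSys_vol] at h
    exact h
  exact B13.bound118_of_logHalfBound _ _ _ _ hB (hlog n) hvol

/-! ## §3  Monotonicity of (b) in its constants -/

/-- (b) is monotone: a larger `E₀'` and a smaller `κ'` still bound (`d_{k+1}(X) ≥ 0`). [cite: Balaban1987RG1, (1.18) p.263 (bookkeeping)] -/
theorem bound118OnUc_mono (Ψ : IntFormula) (Mc k : ℕ) (α₀ α₁ : ℝ) {E₀ E₀' κ κ' : ℝ} (hE : E₀ ≤ E₀') (hκ : κ' ≤ κ) (hE₀' : 0 ≤ E₀')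
    (h : Ψ.Bound118OnUc F Mc k α₀ α₁ E₀ κ) : Ψ.Bound118OnUc F Mc k α₀ α₁ E₀' κ' := by
  rw [bound118OnUc_iff_bound118] at h ⊢
  intro n
  exact B13.bound118_mono _ _ _ hE hκ hE₀' (h n)

end Summit.QuantumFields.YangMills.Theorems.BalabanUVNodesPortS1

end
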